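import Literature.MathematicalPhysics.KineticTheory.Sweep1CanonicalAssemblyProofs
import HarnessLib

/-!
# Lanford's theorem in mode B (`lanford_tendstoEmpirical`): the canonical BBGKY-side term-by-term
# analysis as a named fact, and the decomposition assembly

Topic `Literature/MathematicalPhysics/KineticTheory`. Decomposition (librarian `fact-decompose`,
2026-08-16) of the XL named fact `lanford_tendstoEmpirical` (**hilbert6.S08**, `Sweep1.lean`:
Lanford's theorem in mode B for the canonical ensemble of hard spheres on `T^d` — Lanford 1975;
Cercignani–Illner–Pulvirenti 1994, Thm. 4.4.1 with §4.2's canonical measures;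
Gallagher–Saint-Raymond–Texier 2013, Thm. 8 and §6.1).

The tree PROVES (`Sweep1EmpiricalProofs`, `Sweep1CanonicalDataProofs`,
`Sweep1CanonicalAssemblyProofs`: `lanford_tendstoEmpirical_of_bbgkySide (h) : lanford_tendstoEmpirical`)
everything of the printed proof except its BBGKY side: the Ukai–Lanford solution with its uniform
Gaussian bound, the summation of the Boltzmann Duhamel series and dominated convergence (CIP
Thm. 4.4.1, Steps 2–4, Boltzmann half), admissibility and convergence of the conditioned data
(GST Prop. 6.1.2), eventual positivity of the partition functions and mode A ⇒ mode B. The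
remaining input `h` is vendored here, verbatim, as ONE named fact
`lanford_canonical_bbgkySide`: for Lanford data of mass one, exact Boltzmann–Grad sequences and
hard-sphere flows, the Duhamel terms of the BBGKY hierarchy of the conditioned (canonical) data
exist as measurable functions with uniform majorants `M_s rⁿ e^{−βE}` (GST Thm. 6 / CIP Step 3,
BBGKY half), sum to versions of the marginals of the transported conditioned densities (CIP
Thm. 4.3.1, iterated Duhamel formula) and converge term by term, in the sense of observables and
locally uniformly off the diagonal, to the Boltzmann Duhamel terms (GST Part III, proof of Thm. 8;
CIP Step 1). It is the canonical twin of the remaining input of hilbert6.S02 `lanford`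
(`lanford_of_bbgkySide`, `LanfordAssembly.lean`), concerns objects absent from the statement of
`lanford_tendstoEmpirical`, and is not a rewording of it. `lanford_tendstoEmpirical_holds_of` is the
decomposition assembly. No other definition.

## References

* C. Cercignani, R. Illner, M. Pulvirenti, *The Mathematical Theory of Dilute Gases*, Applied
  Mathematical Sciences 106, Springer (1994), §4.3 Thm 4.3.1, §4.4 Thm 4.4.1, proof, Steps 1–4,
  pp. 77–86, §4.6. [CIP1994]
* I. Gallagher, L. Saint-Raymond, B. Texier, *From Newton to Boltzmann: hard spheres and
  short-range potentials*, EMS ZLAM (2013) = arXiv:1208.5753, §6.1 Prop. 6.1.2, Thm. 6 (p. 25),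
  Thm. 8 (p. 35), Part III Ch. 18 §2 (pp. 87–88). [GST2013]
* O. E. Lanford, *Time evolution of large classical systems*, LNP 38 (1975) 1–111. [Lanford1975]
-/

open MeasureTheory Metric Real Set Filter Topology Function
open scoped ENNReal

namespace Literature.MathematicalPhysics.KineticTheory

noncomputable section

open Literature.Analysis.FluidPDE

variable {d : Type*} [Fintype d]

/-- NAMED FACT — **the canonical BBGKY-side term-by-term analysis of Lanford's proof**
(Gallagher–Saint-Raymond–Texier 2013, Thm. 6 (uniform bounds for the BBGKY hierarchy) and Part III
(term-by-term convergence, proof of Thm. 8), for the conditioned data of §6.1;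
Cercignani–Illner–Pulvirenti 1994, Thm. 4.3.1 iterated and Thm. 4.4.1, proof, Steps 1 and 3).
For `d ≥ 2` and all `β₀, C₀ > 0` there is a horizon `T_B > 0` such that for every Lanford datum `f₀`
of mass one, every exact Boltzmann–Grad sequence `N_k ε_k^{d−1} = 1` (`ε_k < 1/2`) and all
hard-sphere flows `Φ k` on `N_k` spheres of `T^d`, there are measurable `s`-particle functions
`A_k^{(s),n}(t)`, `t ∈ [0, T_B]` (the Duhamel terms of the BBGKY hierarchy of the conditioned data),
with uniform majorants `|A_k^{(s),n}(t, Z)| ≤ M_s rⁿ e^{−β E(Z)}` (`0 ≤ r < 1`, `β > 0`), whose sums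
`∑_n A_k^{(s),n}(t)` are versions of the marginals of the good-set-restricted transported conditioned
densities `(1_{good} · 𝒵_N⁻¹ 1_{D_ε^N} f₀^{⊗N} ∘ Φ^N_{−t})^{(s)}`, and which converge term by term —
tested against compactly supported continuous velocity observables, locally uniformly off the
position diagonal, uniformly on `[0, T_B]` — to the Boltzmann Duhamel terms
`Q⁰_{s,s+n}(t) f₀^{⊗(s+n)}` (`boltzmannDuhamelTerm`). Verbatim the hypothesis of
`lanford_tendstoEmpirical_of_bbgkySide`. [cite: GST2013, Thm. 6 (p. 25) and Part III, Ch. 18 §2, proof of Thm. 8 (pp. 87–88), with Prop. 6.1.2]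
[cite: CIP1994, §4.3 Thm 4.3.1 and §4.4 Thm 4.4.1, proof, Steps 1 and 3 (pp. 77–86)] -/
def lanford_canonical_bbgkySide : Prop :=
  ∀ (_hd : 2 ≤ Fintype.card d) {β₀ C₀ : ℝ}, 0 < β₀ → 0 < C₀ →
    ∃ T_B > (0 : ℝ), ∀ f₀ : UnitAddTorus d → EuclideanSpace ℝ d → ℝ, IsLanfordDatum β₀ C₀ f₀ →
      ∫ x, ∫ v, f₀ x v = 1 →
      ∀ (Nk : ℕ → ℕ) (ε : ℕ → ℝ), IsBoltzmannGradSequenceExact d 1 Nk ε → (∀ k, ε k < 2⁻¹) →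
        ∀ Φ : (k : ℕ) → HardSphereFlow (Torus.geometry d) (ε k) (Nk k),
          ∃ (A : ℕ → (s : ℕ) → ℕ → ℝ → Config s d (UnitAddTorus d) → ℝ) (M : ℕ → ℝ) (r β : ℝ),
            0 ≤ r ∧ r < 1 ∧ 0 < β ∧
            (∀ k s n, ∀ t ∈ Icc 0 T_B, Measurable (A k s n t)) ∧
            (∀ k s n, ∀ t ∈ Icc 0 T_B, ∀ Z,
              |A k s n t Z| ≤ M s * r ^ n * exp (-β * configEnergy Z)) ∧
            (∀ k s, ∀ t ∈ Icc 0 T_B,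
              (fun Z => ∑' n, A k s n t Z) =ᵐ[volume]
                nthMarginal (Nk k) s ((Φ k).good.indicator (hsTransport (Φ k) t
                  (canonicalDensity (Torus.geometry d) (ε k) (Nk k) (uncurry f₀))))) ∧
            (∀ (s n : ℕ) (φ : (Fin s → EuclideanSpace ℝ d) → ℝ), Continuous φ →
              HasCompactSupport φ →
              ∀ K ⊆ offDiag (X := UnitAddTorus d) s, IsCompact K → ∀ δ > (0 : ℝ),
                ∀ᶠ k in atTop, ∀ t ∈ Icc 0 T_B, ∀ xs ∈ K,
                  |velocityAverage φ (A k s n t) xs -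
                    velocityAverage φ (boltzmannDuhamelTerm (Torus.geometry d) n s t
                      (fun j => tensorPow j (uncurry f₀))) xs| ≤ δ)

/-- **`lanford_tendstoEmpirical` (hilbert6.S08) from the canonical BBGKY-side term-by-term
analysis** — the decomposition assembly, i.e. the tree's proved
`lanford_tendstoEmpirical_of_bbgkySide`. [cite: CIP1994, §4.4 Thm 4.4.1, proof, Steps 1–4, pp. 77–86, and §4.6] -/
theorem lanford_tendstoEmpirical_holds_of :
    lanford_canonical_bbgkySide (d := d) → lanford_tendstoEmpirical (d := d) :=
  fun h => lanford_tendstoEmpirical_of_bbgkySide h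

end

end Literature.MathematicalPhysics.KineticTheory
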